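import Summits.RiemannHypothesis.RiemannHypothesis.Theorems.WeilColumnZeroSumDecay
import HarnessLib

/-!
# Zero-side bound for the BILINEAR Weil form `W(φ ⋆ ψ̃)` from pointwise decay at the zeros (RH-FREE)

WEIL column (LADDER-RH, W-P(P2); tier-1 `ThetaCertificateSound`, item PR of THETA-ASSIGN v1.0 §3 — the «bracket» of the full-form
assembly (WEIL-THEORY-R3 v1.3 §3⁗): after the polarisation `Q(G⁻ − T⁻) = Q(T⁻) + [Q(G⁻) − W(G⁻⋆T̃⁻) − W(T⁻⋆G̃⁻)]` the cross
terms are bilinear). If `‖φ̂(ρ)‖ ≤ A/‖ρ − ½‖` and `‖ψ̂(ρ)‖ ≤ B/‖ρ − ½‖` at every nontrivial zero, then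
* `norm_weilZeroSidePartial_bilinear_le`: every truncation `|Σ_{|Im ρ|≤T} m(ρ)(φ⋆ψ̃)^(ρ)| ≤ 0.0463·(197/196)·A·B`
  (`(φ⋆ψ̃)^(ρ) = φ̂(ρ)·conj ψ̂(1−ρ̄)`, `‖(1−ρ̄) − ½‖ = ‖ρ − ½‖`, Ford's `Σ m/|ρ|² ≤ 0.0463`, `|Im ρ| > 14`);
* `norm_weilFunctional_bilinear_le_of_decay`: `‖W(φ ⋆ ψ̃)‖ ≤ 0.0463·(197/196)·A·B` (explicit formula `explicit_formula_holds`).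
The quadratic case `φ = ψ` is p413181's `re_weilQuadratic_le_of_decay`. RH-free; nothing here bears on the truth of RH.
-/

set_option linter.dupNamespace false

noncomputable section

open Complex Filter Set Topology
open scoped ComplexConjugate
open Finset Literature.NumberTheory.LFunctions

namespace Summit.RiemannHypothesis.RiemannHypothesis.Theorems.WeilColumn.ThetaMellin

/-- `‖ρ‖² ≤ (197/196)·‖ρ − ½‖²` at a nontrivial zero (`0 < Re ρ < 1`, `|Im ρ| > 14`). [folklore; Ford2002Millennium L. 3.3 setting] -/
theorem normSq_le_normSq_sub_half (ρ : RHWave0.riemannZetaNontrivialZeros) :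
    ‖(ρ : ℂ)‖ ^ 2 ≤ (197 / 196) * ‖(ρ : ℂ) - 1 / 2‖ ^ 2 ∧ 0 < ‖(ρ : ℂ) - 1 / 2‖ ∧ 0 < ‖(ρ : ℂ)‖ ^ 2 := by
  have h14 : 14 < |(ρ : ℂ).im| := FordL33.fourteen_lt_abs_im ρ
  have hre0 : 0 < (ρ : ℂ).re := ZetaZeros.riemannZetaNontrivialZeros.re_pos ρ.2
  have hre1 : (ρ : ℂ).re < 1 := ZetaZeros.riemannZetaNontrivialZeros.re_lt_one ρ.2
  have him2 : 196 < (ρ : ℂ).im ^ 2 := by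
    have : (14 : ℝ) ^ 2 < |(ρ : ℂ).im| ^ 2 := by gcongr
    rw [sq_abs] at this; linarith
  have hnorm : ‖(ρ : ℂ)‖ ^ 2 = (ρ : ℂ).re ^ 2 + (ρ : ℂ).im ^ 2 := by
    rw [Complex.sq_norm, Complex.normSq_apply]; ring
  have hnorm' : ‖(ρ : ℂ) - 1 / 2‖ ^ 2 = ((ρ : ℂ).re - 1 / 2) ^ 2 + (ρ : ℂ).im ^ 2 := by
    rw [Complex.sq_norm, Complex.normSq_apply]; simp; ring
  have hρ'pos : 0 < ‖(ρ : ℂ) - 1 / 2‖ ^ 2 := by rw [hnorm']; nlinarith [sq_nonneg ((ρ : ℂ).re - 1 / 2)]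
  refine ⟨by rw [hnorm, hnorm']; nlinarith, ?_, by rw [hnorm]; nlinarith⟩
  rcases (norm_nonneg ((ρ : ℂ) - 1 / 2)).eq_or_lt with h0 | h0
  · rw [← h0] at hρ'pos; norm_num at hρ'pos
  · exact h0

/-- `‖(1 − conj ρ) − ½‖ = ‖ρ − ½‖`. [folklore] -/
theorem norm_one_sub_conj_sub_half (ρ : ℂ) : ‖(1 - conj ρ) - 1 / 2‖ = ‖ρ - 1 / 2‖ := by
  have h1 : ‖(1 - conj ρ) - 1 / 2‖ ^ 2 = (ρ.re - 1 / 2) ^ 2 + ρ.im ^ 2 := by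
    rw [Complex.sq_norm, Complex.normSq_apply]; simp; ring
  have h2 : ‖ρ - 1 / 2‖ ^ 2 = (ρ.re - 1 / 2) ^ 2 + ρ.im ^ 2 := by
    rw [Complex.sq_norm, Complex.normSq_apply]; simp; ring
  exact (sq_eq_sq₀ (norm_nonneg _) (norm_nonneg _)).mp (h1.trans h2.symm)

/-- Termwise bound: `m(ρ)·‖(φ⋆ψ̃)^(ρ)‖ ≤ (197/196)·A·B·m(ρ)/‖ρ‖²`. [folklore] -/
theorem norm_term_bilinear_le {φ ψ : ℝ → ℂ} (hφ : IsWeilTest φ) (hψ : IsWeilTest ψ) {A B : ℝ} (hA : 0 ≤ A) (hB : 0 ≤ B)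
    (ρ : RHWave0.riemannZetaNontrivialZeros)
    (ha : ‖weilMellin φ ρ‖ ≤ A / ‖(ρ : ℂ) - 1 / 2‖)
    (hb : ‖weilMellin ψ (1 - conj (ρ : ℂ))‖ ≤ B / ‖(1 - conj (ρ : ℂ)) - 1 / 2‖) :
    ‖(riemannZetaZeroOrder (ρ : ℂ) : ℂ) * weilMellin (weilConv φ (weilReflect ψ)) ρ‖ ≤
      (197 / 196) * (A * B) * ((riemannZetaZeroOrder (ρ : ℂ) : ℝ) / ‖(ρ : ℂ)‖ ^ 2) := by
  obtain ⟨hcmp, hpos, hpos2⟩ := normSq_le_normSq_sub_half ρ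
  have hm : (0 : ℝ) < riemannZetaZeroOrder (ρ : ℂ) := FordL33.order_pos ρ
  rw [norm_one_sub_conj_sub_half] at hb
  rw [weilMellin_weilConv_holds hφ.1.continuous hφ.2 hψ.weilReflect.1.continuous hψ.weilReflect.2,
    weilMellin_weilReflect_holds, norm_mul, norm_mul, Complex.norm_conj, Complex.norm_intCast, abs_of_pos (by exact_mod_cast hm)]
  have hprod : ‖weilMellin φ ρ‖ * ‖weilMellin ψ (1 - conj (ρ : ℂ))‖ ≤ A * B / ‖(ρ : ℂ) - 1 / 2‖ ^ 2 := by
    calc ‖weilMellin φ ρ‖ * ‖weilMellin ψ (1 - conj (ρ : ℂ))‖ ≤ (A / ‖(ρ : ℂ) - 1 / 2‖) * (B / ‖(ρ : ℂ) - 1 / 2‖) :=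
          mul_le_mul ha hb (norm_nonneg _) (div_nonneg hA (norm_nonneg _))
      _ = A * B / ‖(ρ : ℂ) - 1 / 2‖ ^ 2 := by rw [div_mul_div_comm, sq]
  have hprod' : ‖weilMellin φ ρ‖ * ‖weilMellin ψ (1 - conj (ρ : ℂ))‖ ≤ (197 / 196) * (A * B) / ‖(ρ : ℂ)‖ ^ 2 := by
    refine hprod.trans ?_
    rw [div_le_div_iff₀ (pow_pos hpos 2) hpos2]
    have hAB : 0 ≤ A * B := mul_nonneg hA hB
    nlinarith
  calc (riemannZetaZeroOrder (ρ : ℂ) : ℝ) * (‖weilMellin φ ρ‖ * ‖weilMellin ψ (1 - conj (ρ : ℂ))‖)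
      ≤ (riemannZetaZeroOrder (ρ : ℂ) : ℝ) * ((197 / 196) * (A * B) / ‖(ρ : ℂ)‖ ^ 2) :=
        mul_le_mul_of_nonneg_left hprod' hm.le
    _ = (197 / 196) * (A * B) * ((riemannZetaZeroOrder (ρ : ℂ) : ℝ) / ‖(ρ : ℂ)‖ ^ 2) := by ring

/-- **BILINEAR ZERO-SIDE BOUND, every truncation (RH-free).** [cite: Ford2002Millennium, Lemma 3.3 (the constant 0.0463)] -/
theorem norm_weilZeroSidePartial_bilinear_le {φ ψ : ℝ → ℂ} (hφ : IsWeilTest φ) (hψ : IsWeilTest ψ) {A B : ℝ}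
    (hA : 0 ≤ A) (hB : 0 ≤ B)
    (ha : ∀ ρ : ℂ, ρ ∈ RHWave0.riemannZetaNontrivialZeros → ‖weilMellin φ ρ‖ ≤ A / ‖ρ - 1 / 2‖)
    (hb : ∀ ρ : ℂ, ρ ∈ RHWave0.riemannZetaNontrivialZeros → ‖weilMellin ψ ρ‖ ≤ B / ‖ρ - 1 / 2‖) (T : ℝ) :
    ‖weilZeroSidePartial (weilConv φ (weilReflect ψ)) T‖ ≤ 0.0463 * ((197 / 196) * (A * B)) := by
  rw [weilZeroSidePartial_eq_sum]
  refine (norm_sum_le _ _).trans ?_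
  have h1 : ∑ ρ ∈ weilZeroFinset T, ‖(riemannZetaZeroOrder (ρ : ℂ) : ℂ) * weilMellin (weilConv φ (weilReflect ψ)) ρ‖ ≤
      ∑ ρ ∈ weilZeroFinset T, (197 / 196) * (A * B) * ((riemannZetaZeroOrder (ρ : ℂ) : ℝ) / ‖(ρ : ℂ)‖ ^ 2) := by
    refine sum_le_sum fun ρ _ ↦ norm_term_bilinear_le hφ hψ hA hB ρ (ha ρ ρ.2) (hb _ ?_)
    -- `1 − conj ρ` is again a nontrivial zero
    exact ZetaZeros.riemannZetaNontrivialZeros.one_sub_conj_mem ρ.2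
  rw [← mul_sum] at h1
  have h3 := sum_zeroOrder_div_norm_sq_le (weilZeroFinset T)
  have h4 : (197 / 196) * (A * B) * ∑ ρ ∈ weilZeroFinset T, (riemannZetaZeroOrder (ρ : ℂ) : ℝ) / ‖(ρ : ℂ)‖ ^ 2 ≤
      (197 / 196) * (A * B) * 0.0463 := mul_le_mul_of_nonneg_left h3 (by positivity)
  linarith

/-- **`‖W(φ ⋆ ψ̃)‖ ≤ 0.0463·(197/196)·A·B` from pointwise decay at the zeros (RH-free; explicit formula `explicit_formula_holds`).**
[cite: Ford2002Millennium, Lemma 3.3 (the constant 0.0463)] -/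
theorem norm_weilFunctional_bilinear_le_of_decay {φ ψ : ℝ → ℂ} (hφ : IsWeilTest φ) (hψ : IsWeilTest ψ) {A B : ℝ}
    (hA : 0 ≤ A) (hB : 0 ≤ B)
    (ha : ∀ ρ : ℂ, ρ ∈ RHWave0.riemannZetaNontrivialZeros → ‖weilMellin φ ρ‖ ≤ A / ‖ρ - 1 / 2‖)
    (hb : ∀ ρ : ℂ, ρ ∈ RHWave0.riemannZetaNontrivialZeros → ‖weilMellin ψ ρ‖ ≤ B / ‖ρ - 1 / 2‖) :
    ‖weilFunctional (weilConv φ (weilReflect ψ))‖ ≤ 0.0463 * ((197 / 196) * (A * B)) := by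
  have hk : IsWeilTest (weilConv φ (weilReflect ψ)) := hφ.weilConv hψ.weilReflect
  have hlim : Tendsto (fun T ↦ ‖weilZeroSidePartial (weilConv φ (weilReflect ψ)) T‖) atTop
      (𝓝 ‖weilFunctional (weilConv φ (weilReflect ψ))‖) :=
    (continuous_norm.tendsto _).comp (explicit_formula_holds hk)
  exact le_of_tendsto' hlim fun T ↦ norm_weilZeroSidePartial_bilinear_le hφ hψ hA hB ha hb T

end Summit.RiemannHypothesis.RiemannHypothesis.Theorems.WeilColumn.ThetaMellin
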